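import Literature.Probability.Percolation.TriPolyhexDomain
import HarnessLib

/-!
# Marking a discrete domain at an arbitrary set of markable boundary darts («TRI-MARK-DARTS»)

Topic `Literature/Probability/Percolation`; family `crit-perc` (discrete domains of the triangular lattice, Bollobás–Riordan, *Percolation*, Ch. 7 §7.2.2),
a rider on `TriPolyhexDomain.lean` (`TriMarkedDomain.withMarks`: marking a discrete domain at given POSITIONS `q 0 < q 1 < ⋯` along its boundary cycle, each
carrying the «second outside neighbour» condition as a hypothesis on the darts visited one and two steps earlier) and `TriDiscShelling.lean` (`IsTriDisc`: the
boundary walk `triBdryIter` is a single cycle — `cycle`, `iter_eq_iter_iff`, `injOn`, `rebase`).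

The positional interface of `withMarks` is only usable on domains whose boundary walk has been computed by hand (the lineage's `hexBall1Five`, `rhombus24SevenA/B`:
positions by `decide`). For a FAMILY of domains (the sandpile class of HOME `FINDING-BSPAN-SLIDE-INDUCTION.md`, or any other) one wants to mark a domain at a SET of
boundary darts described locally. This file supplies that constructor:

* `IsMarkable G d` — **a markable boundary dart**, locally: `d = (g, o)` is a boundary dart, its predecessor on the boundary cycle is a dart `(g, o')` with the SAME tail
  (so `d` is not the first dart out of `g`), and the predecessor of that one has a DIFFERENT tail (so `d` is the SECOND dart out of `g`) — Bollobás–Riordan's «each marked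
  site is adjacent to at least two sites of `T ∖ G`» and «marked at its second outside neighbour» (p. 169), stated through `triBdrySucc` only;
* `visitTime D d` — the first visit time of a boundary dart from the base (`< #∂G`; `triBdryIter_visitTime`; injective on the boundary darts);
* `iter_visitTime_add_pred` / `iter_visitTime_add_pred_pred` — the darts one and two steps before `d` on the cycle are its `triBdrySucc`-predecessors;
* ★★★ `TriMarkedDomain.ofDarts` — **THE CONSTRUCTOR**: a discrete domain `D` (any number of marks, which are forgotten) and a finite set `S` of `k ≥ 1` markable boundary darts
  with pairwise distinct tails give a `k`-marked discrete domain on the same site set whose marked darts are exactly the darts of `S`, numbered by visit time from `D.base`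
  (`ofDarts_verts`, ★ `ofDarts_markDart_mem`, ★ `exists_ofDarts_markDart_eq` — every dart of `S` is a marked dart, ★ `ofDarts_markDart_injective`).

## References
* B. Bollobás, O. Riordan, *Percolation*, Cambridge University Press (2006), Ch. 7 §7.2.2 pp. 168–169 (discrete domains; marked sites «adjacent to at least two sites of
  `T ∖ G`», arcs from «the second neighbour of `v_i`»).

## Mathlib / tree
Mathlib: `Nat.find`, `Nat.find_spec`, `Nat.find_min'`, `Finset.orderEmbOfFin`, `Finset.orderEmbOfFin_mem`, `Finset.range_orderEmbOfFin`, `Finset.card_image_of_injOn`,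
`OrderEmbedding.strictMono`. Tree: `TriPolyhexDomain` (`withMarks`, `withMarks_verts`, `withMarks_markDart`), `TriDiscShelling` (`TriMarkedDomain.isTriDisc`, `IsTriDisc.cycle`,
`iter_eq_iter_iff`, `iter_add_card`, `card_pos`), `TriDiscreteDomain` (`TriMarkedDomain`, `markDart`, `triBdryIter_succ`, `triBdryIter_mem`, `triBdrySucc_mem`).
-/

noncomputable section

open Finset Literature.Probability.LatticeModels

namespace Literature.Probability.Percolation

/-! ### Markable darts -/

/-- **A markable boundary dart** `d = (g, o)` of a site set `G`: a boundary dart whose predecessor on the boundary cycle is a boundary dart with the same tail `g`, whose own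
predecessor has a different tail — `o` is the SECOND outside neighbour of `g` met by the anticlockwise boundary walk (Bollobás–Riordan 2006, p. 169: marked sites «adjacent to at
least two sites of `T ∖ G`», marked at the second outside neighbour). [cite: BollobasRiordan2006, Ch. 7 §7.2.2 p. 169] -/
structure IsMarkable (G : Finset (Site 2)) (d : Site 2 × Site 2) : Prop where
  /-- `d` is a boundary dart -/
  mem : d ∈ triBdryDarts G
  /-- the two previous darts: `d₂ → d₁ → d` along the boundary walk, `d₁` with the same tail as `d`, `d₂` with a different tail -/
  pred : ∃ d₁ ∈ triBdryDarts G, triBdrySucc G d₁ = d ∧ d₁.1 = d.1 ∧ ∃ d₂ ∈ triBdryDarts G, triBdrySucc G d₂ = d₁ ∧ d₂.1 ≠ d.1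

namespace TriMarkedDomain

variable {j : ℕ} (D : TriMarkedDomain j)

/-! ### Visit times -/

/-- **the first visit time** of a boundary dart from the base of the domain (and `0` off the boundary). [cite: BollobasRiordan2006, Ch. 7 §7.2.2 p. 168 (the boundary of a discrete domain is one cycle); lane plumbing] -/
def visitTime (d : Site 2 × Site 2) : ℕ :=
  if h : d ∈ triBdryDarts D.verts then Nat.find (D.cycle d h) else 0

/-- the visit time is a position on the cycle. [cite: BollobasRiordan2006, Ch. 7 §7.2.2 p. 168 (the boundary of a discrete domain is one cycle); lane plumbing] -/
theorem visitTime_lt {d : Site 2 × Site 2} (hd : d ∈ triBdryDarts D.verts) : D.visitTime d < #(triBdryDarts D.verts) := by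
  unfold visitTime
  rw [dif_pos hd]
  exact (Nat.find_spec (D.cycle d hd)).1

/-- the walk visits `d` at its visit time. [cite: BollobasRiordan2006, Ch. 7 §7.2.2 p. 168 (the boundary of a discrete domain is one cycle); lane plumbing] -/
theorem triBdryIter_visitTime {d : Site 2 × Site 2} (hd : d ∈ triBdryDarts D.verts) : triBdryIter D.verts D.base (D.visitTime d) = d := by
  unfold visitTime
  rw [dif_pos hd]
  exact (Nat.find_spec (D.cycle d hd)).2

/-- the visit time is injective on the boundary darts. [cite: BollobasRiordan2006, Ch. 7 §7.2.2 p. 168 (the boundary of a discrete domain is one cycle); lane plumbing] -/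
theorem visitTime_injOn : Set.InjOn D.visitTime (triBdryDarts D.verts : Set (Site 2 × Site 2)) := by
  intro d hd d' hd' h
  rw [← D.triBdryIter_visitTime (mem_coe.1 hd), ← D.triBdryIter_visitTime (mem_coe.1 hd'), h]

/-- **the dart one step before `d`**: if `triBdrySucc d₁ = d` for boundary darts `d₁`, `d`, then the walk is at `d₁` at time `visitTime d + (#∂ − 1)`. [cite: BollobasRiordan2006, Ch. 7 §7.2.2 p. 168 (the boundary of a discrete domain is one cycle); lane plumbing] -/
theorem iter_visitTime_add_pred {d d₁ : Site 2 × Site 2} (hd : d ∈ triBdryDarts D.verts) (hd₁ : d₁ ∈ triBdryDarts D.verts)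
    (hsucc : triBdrySucc D.verts d₁ = d) :
    triBdryIter D.verts D.base (D.visitTime d + (#(triBdryDarts D.verts) - 1)) = d₁ := by
  have hD := D.isTriDisc
  have hL := hD.card_pos
  set L := #(triBdryDarts D.verts) with hLdef
  -- `d₁` is visited at some time `s`, and then `d` at time `s + 1`
  obtain ⟨s, -, hs⟩ := D.cycle d₁ hd₁
  have hs1 : triBdryIter D.verts D.base (s + 1) = d := by rw [triBdryIter_succ, hs, hsucc]
  have hmod : (s + 1) % L = D.visitTime d % L := hD.iter_eq_iter_iff.1 (hs1.trans (D.triBdryIter_visitTime hd).symm)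
  rw [← hs]
  apply hD.iter_eq_iter_iff.2
  -- `visitTime d + (L - 1) ≡ s + 1 + (L - 1) = s + L ≡ s`
  have e : (D.visitTime d + (L - 1)) % L = (s + 1 + (L - 1)) % L := by rw [Nat.add_mod, ← hmod, ← Nat.add_mod]
  rw [e, show s + 1 + (L - 1) = s + L by omega, Nat.add_mod_right]

/-- **the dart two steps before `d`**. [cite: BollobasRiordan2006, Ch. 7 §7.2.2 p. 168 (the boundary of a discrete domain is one cycle); lane plumbing] -/
theorem iter_visitTime_add_pred_pred {d d₁ d₂ : Site 2 × Site 2} (hd : d ∈ triBdryDarts D.verts) (hd₁ : d₁ ∈ triBdryDarts D.verts)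
    (hd₂ : d₂ ∈ triBdryDarts D.verts) (hsucc : triBdrySucc D.verts d₁ = d) (hsucc₂ : triBdrySucc D.verts d₂ = d₁) :
    triBdryIter D.verts D.base (D.visitTime d + (#(triBdryDarts D.verts) - 2)) = d₂ := by
  have hD := D.isTriDisc
  have hL := hD.card_pos
  set L := #(triBdryDarts D.verts) with hLdef
  obtain ⟨s, -, hs⟩ := D.cycle d₂ hd₂
  have hs2 : triBdryIter D.verts D.base (s + 2) = d := by
    rw [show s + 2 = s + 1 + 1 by rfl, triBdryIter_succ, triBdryIter_succ, hs, hsucc₂, hsucc]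
  have hmod : (s + 2) % L = D.visitTime d % L := hD.iter_eq_iter_iff.1 (hs2.trans (D.triBdryIter_visitTime hd).symm)
  rw [← hs]
  apply hD.iter_eq_iter_iff.2
  -- two boundary darts `d₂ ≠ ?`: the cycle has length at least `2`, so `L - 2 + 2 = L`
  have hL2 : 2 ≤ L := by
    -- `d₁ ≠ d` (their tails agree, so equal darts would make `triBdrySucc d = d`, impossible) — we only need two distinct boundary darts
    by_contra hlt
    have hL1 : L = 1 := by omega
    have hsub : d₁ = d := by
      have h1 := Finset.card_le_one.1 (by rw [← hLdef]; omega) d₁ hd₁ d hd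
      exact h1
    -- `triBdrySucc d = d` contradicts the definition of the successor (it changes exactly one component to a different site)
    rw [hsub] at hsucc
    unfold triBdrySucc at hsucc
    obtain ⟨hu, hv, hadj⟩ := mem_triBdryDarts.1 hd
    split_ifs at hsucc with hw
    · have h1 := congrArg Prod.fst hsucc
      simp only at h1
      exact (triLeftApex_ne hadj).1 h1
    · have h2 := congrArg Prod.snd hsucc
      simp only at h2
      exact (triLeftApex_ne hadj).2 h2
  have e : (D.visitTime d + (L - 2)) % L = (s + 2 + (L - 2)) % L := by rw [Nat.add_mod, ← hmod, ← Nat.add_mod]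
  rw [e, show s + 2 + (L - 2) = s + L by omega, Nat.add_mod_right]

/-! ### The constructor -/

variable {k : ℕ}

/-- the visit times of a set of boundary darts. [cite: BollobasRiordan2006, Ch. 7 §7.2.2 p. 168 (the boundary of a discrete domain is one cycle); lane plumbing] -/
def visitTimes (S : Finset (Site 2 × Site 2)) : Finset ℕ := S.image D.visitTime

/-- they are as many as the darts. [cite: BollobasRiordan2006, Ch. 7 §7.2.2 p. 168 (the boundary of a discrete domain is one cycle); lane plumbing] -/
theorem card_visitTimes {S : Finset (Site 2 × Site 2)} (hS : ∀ d ∈ S, d ∈ triBdryDarts D.verts) : #(D.visitTimes S) = #S :=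
  Finset.card_image_of_injOn fun d hd d' hd' h => D.visitTime_injOn (hS d hd) (hS d' hd') h

/-- **the positions**: the sorted visit times of the darts of `S`. [cite: BollobasRiordan2006, Ch. 7 §7.2.2 p. 168 (the boundary of a discrete domain is one cycle); lane plumbing] -/
def dartPos (S : Finset (Site 2 × Site 2)) (hT : #(D.visitTimes S) = k) : Fin k → ℕ := fun i => (D.visitTimes S).orderEmbOfFin hT i

/-- every position is the visit time of a dart of `S`. [cite: BollobasRiordan2006, Ch. 7 §7.2.2 p. 168 (the boundary of a discrete domain is one cycle); lane plumbing] -/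
theorem exists_visitTime_eq_dartPos (S : Finset (Site 2 × Site 2)) (hT : #(D.visitTimes S) = k) (i : Fin k) : ∃ d ∈ S, D.visitTime d = D.dartPos S hT i := by
  obtain ⟨d, hd, e⟩ := Finset.mem_image.1 (Finset.orderEmbOfFin_mem (D.visitTimes S) hT i)
  exact ⟨d, hd, e⟩

/-- the positions are strictly increasing. [cite: BollobasRiordan2006, Ch. 7 §7.2.2 p. 168 (the boundary of a discrete domain is one cycle); lane plumbing] -/
theorem dartPos_strictMono (S : Finset (Site 2 × Site 2)) (hT : #(D.visitTimes S) = k) : StrictMono (D.dartPos S hT) :=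
  ((D.visitTimes S).orderEmbOfFin hT).strictMono

/-- the positions lie within one period from the first. [cite: BollobasRiordan2006, Ch. 7 §7.2.2 p. 168 (the boundary of a discrete domain is one cycle); lane plumbing] -/
theorem dartPos_lt (hk : 0 < k) (S : Finset (Site 2 × Site 2)) (hmem : ∀ d ∈ S, d ∈ triBdryDarts D.verts) (hT : #(D.visitTimes S) = k) (i : Fin k) :
    D.dartPos S hT i < D.dartPos S hT ⟨0, hk⟩ + #(triBdryDarts D.verts) := by
  obtain ⟨d, hd, e⟩ := D.exists_visitTime_eq_dartPos S hT i
  have := D.visitTime_lt (hmem d hd)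
  rw [e] at this
  omega

/-- the dart before a position has the same tail (markability, first half). [cite: BollobasRiordan2006, Ch. 7 §7.2.2 p. 169] -/
theorem fst_iter_dartPos_pred (S : Finset (Site 2 × Site 2)) (hS : ∀ d ∈ S, IsMarkable D.verts d) (hT : #(D.visitTimes S) = k) (i : Fin k) :
    (triBdryIter D.verts D.base (D.dartPos S hT i + (#(triBdryDarts D.verts) - 1))).1 = (triBdryIter D.verts D.base (D.dartPos S hT i)).1 := by
  obtain ⟨d, hd, e⟩ := D.exists_visitTime_eq_dartPos S hT i
  obtain ⟨d₁, hd₁, hsucc, htail, -⟩ := (hS d hd).pred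
  rw [← e, D.iter_visitTime_add_pred (hS d hd).mem hd₁ hsucc, D.triBdryIter_visitTime (hS d hd).mem, htail]

/-- the dart two before a position has a different tail (markability, second half). [cite: BollobasRiordan2006, Ch. 7 §7.2.2 p. 169] -/
theorem fst_iter_dartPos_pred_pred (S : Finset (Site 2 × Site 2)) (hS : ∀ d ∈ S, IsMarkable D.verts d) (hT : #(D.visitTimes S) = k) (i : Fin k) :
    (triBdryIter D.verts D.base (D.dartPos S hT i + (#(triBdryDarts D.verts) - 2))).1 ≠ (triBdryIter D.verts D.base (D.dartPos S hT i)).1 := by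
  obtain ⟨d, hd, e⟩ := D.exists_visitTime_eq_dartPos S hT i
  obtain ⟨d₁, hd₁, hsucc, -, d₂, hd₂, hsucc₂, htail₂⟩ := (hS d hd).pred
  rw [← e, D.iter_visitTime_add_pred_pred (hS d hd).mem hd₁ hd₂ hsucc hsucc₂, D.triBdryIter_visitTime (hS d hd).mem]
  exact htail₂

/-- the darts at the positions have distinct tails. [cite: BollobasRiordan2006, Ch. 7 §7.2.2 p. 168 (the boundary of a discrete domain is one cycle); lane plumbing] -/
theorem fst_iter_dartPos_injective (S : Finset (Site 2 × Site 2)) (hS : ∀ d ∈ S, IsMarkable D.verts d) (hT : #(D.visitTimes S) = k)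
    (hinj : Set.InjOn Prod.fst (S : Set (Site 2 × Site 2))) : Function.Injective fun i => (triBdryIter D.verts D.base (D.dartPos S hT i)).1 := by
  intro a b hab
  obtain ⟨da, hda, ea⟩ := D.exists_visitTime_eq_dartPos S hT a
  obtain ⟨db, hdb, eb⟩ := D.exists_visitTime_eq_dartPos S hT b
  simp only at hab
  rw [← ea, ← eb, D.triBdryIter_visitTime (hS da hda).mem, D.triBdryIter_visitTime (hS db hdb).mem] at hab
  have hdd : da = db := hinj (mem_coe.2 hda) (mem_coe.2 hdb) hab
  apply ((D.visitTimes S).orderEmbOfFin hT).injective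
  change D.dartPos S hT a = D.dartPos S hT b
  rw [← ea, ← eb, hdd]

/-- ★★★ **MARKING A DISCRETE DOMAIN AT A SET OF MARKABLE DARTS.** A discrete domain `D` (its own marks, if any, are forgotten) and a set `S` of `k ≥ 1` MARKABLE boundary darts
(`IsMarkable`) with pairwise distinct tails give the `k`-marked discrete domain on the same sites whose marked darts are the darts of `S`, numbered increasingly by visit time
from `D.base` and rebased at the first of them (via `withMarks` at the positions `dartPos` = `dartPos` of the visit times).
[cite: BollobasRiordan2006, Ch. 7 §7.2.2 pp. 168–169] -/
def ofDarts (hk : 0 < k) (S : Finset (Site 2 × Site 2)) (hcard : #S = k) (hS : ∀ d ∈ S, IsMarkable D.verts d)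
    (hinj : Set.InjOn Prod.fst (S : Set (Site 2 × Site 2))) : TriMarkedDomain k :=
  have hT : #(D.visitTimes S) = k := (D.card_visitTimes fun d hd => (hS d hd).mem).trans hcard
  D.withMarks hk (D.dartPos S hT) (D.dartPos_strictMono S hT) (D.dartPos_lt hk S (fun d hd => (hS d hd).mem) hT)
    (D.fst_iter_dartPos_pred S hS hT) (D.fst_iter_dartPos_pred_pred S hS hT) (D.fst_iter_dartPos_injective S hS hT hinj)

/-- the site set of `ofDarts`. [cite: BollobasRiordan2006, Ch. 7 §7.2.2 p. 168 (the boundary of a discrete domain is one cycle); lane plumbing] -/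
@[simp] theorem ofDarts_verts (hk : 0 < k) (S : Finset (Site 2 × Site 2)) (hcard : #S = k) (hS) (hinj) :
    (D.ofDarts hk S hcard hS hinj).verts = D.verts := rfl

/-- the marked darts of `ofDarts` are the darts visited at the sorted visit times of `S`. [cite: BollobasRiordan2006, Ch. 7 §7.2.2 p. 168 (the boundary of a discrete domain is one cycle); lane plumbing] -/
theorem ofDarts_markDart (hk : 0 < k) (S : Finset (Site 2 × Site 2)) (hcard : #S = k) (hS : ∀ d ∈ S, IsMarkable D.verts d) (hinj) (i : Fin k) :
    (D.ofDarts hk S hcard hS hinj).markDart i =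
      triBdryIter D.verts D.base (D.dartPos S (((D.card_visitTimes fun d hd => (hS d hd).mem)).trans hcard) i) :=
  have hT : #(D.visitTimes S) = k := (D.card_visitTimes fun d hd => (hS d hd).mem).trans hcard
  D.withMarks_markDart hk (D.dartPos S hT) (D.dartPos_strictMono S hT) (D.dartPos_lt hk S (fun d hd => (hS d hd).mem) hT)
    (D.fst_iter_dartPos_pred S hS hT) (D.fst_iter_dartPos_pred_pred S hS hT) (D.fst_iter_dartPos_injective S hS hT hinj) i

/-- ★ **every marked dart of `ofDarts` is a dart of `S`.** [cite: BollobasRiordan2006, Ch. 7 §7.2.2 p. 169] -/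
theorem ofDarts_markDart_mem (hk : 0 < k) (S : Finset (Site 2 × Site 2)) (hcard : #S = k) (hS : ∀ d ∈ S, IsMarkable D.verts d) (hinj) (i : Fin k) :
    (D.ofDarts hk S hcard hS hinj).markDart i ∈ S := by
  rw [ofDarts_markDart]
  obtain ⟨d, hd, e⟩ := D.exists_visitTime_eq_dartPos S (((D.card_visitTimes fun d hd => (hS d hd).mem)).trans hcard) i
  rw [← e, D.triBdryIter_visitTime (hS d hd).mem]
  exact hd

/-- ★ **every dart of `S` is a marked dart of `ofDarts`.** [cite: BollobasRiordan2006, Ch. 7 §7.2.2 p. 169] -/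
theorem exists_ofDarts_markDart_eq (hk : 0 < k) (S : Finset (Site 2 × Site 2)) (hcard : #S = k) (hS : ∀ d ∈ S, IsMarkable D.verts d) (hinj)
    {d : Site 2 × Site 2} (hd : d ∈ S) : ∃ i : Fin k, (D.ofDarts hk S hcard hS hinj).markDart i = d := by
  have hT : #(D.visitTimes S) = k := (D.card_visitTimes fun d hd => (hS d hd).mem).trans hcard
  have ht : D.visitTime d ∈ Set.range ((D.visitTimes S).orderEmbOfFin hT) := by
    rw [Finset.range_orderEmbOfFin]
    exact mem_coe.2 (Finset.mem_image.2 ⟨d, hd, rfl⟩)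
  obtain ⟨i, hi⟩ := ht
  refine ⟨i, ?_⟩
  rw [ofDarts_markDart]
  change triBdryIter D.verts D.base ((D.visitTimes S).orderEmbOfFin hT i) = d
  rw [hi, D.triBdryIter_visitTime (hS d hd).mem]

/-- ★ the marked darts of `ofDarts` are pairwise distinct (indeed strictly ordered by visit time). [cite: BollobasRiordan2006, Ch. 7 §7.2.2 p. 168 (the boundary of a discrete domain is one cycle); lane plumbing] -/
theorem ofDarts_markDart_injective (hk : 0 < k) (S : Finset (Site 2 × Site 2)) (hcard : #S = k) (hS : ∀ d ∈ S, IsMarkable D.verts d) (hinj) :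
    Function.Injective (D.ofDarts hk S hcard hS hinj).markDart := by
  intro a b hab
  exact (D.ofDarts hk S hcard hS hinj).mark_injective (congrArg Prod.fst hab)

end TriMarkedDomain

end Literature.Probability.Percolation
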